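import Summits.QuantumAdvantage.QuantumAdvantage.Theorems.LocusDialGroupPointerB

/-!
# LocusDialGroupPointerC — ADAPTIVE group-query trees: `AdaptiveGroupPointerLoss3`, `ParityDecisionTreeLoss3` (part C)

Cell decomp-qadv, seat lens-2, generation 17 — tree part «GroupPointer» (supports item stmt-QuantumAdvantage-27137; parts A/B:
the transfer operator with general unit weights and the non-adaptive law `groupHashPointerLoss3`).

§L: an ADAPTIVE `V`-valued query scheme of depth `t` (`GAdaptive Gq`: on answer string `w` the `j`-th coefficient vector
`Gq w j` depends only on `w i`, `i < j`; query value `Σ_{x_l=1} Gq w j l ∈ V`), its leaf map `gleafOf` (via `gleafAux`), and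
the LEAF-FIBRE IDENTITY `gleafOf_eq_iff : gleafOf Gq x = w ↔ ghash (gvec Gq w) x = w` — the leaves are the fibres of ONE group
hash into the product group `Fin t → V` (the leaf's own query bundle `gvec`; uniqueness `eq_gleafOf_of_consistent` by
induction over the query order).  Since part B's fibre bound is uniform in the hash, it applies leaf by leaf:
`adaptiveGroupPointer_loss` (`≤ 3/4·2^{n-1}` whenever `|V| ≤ 2^s`, `24·s·t + 98 ≤ n`), **`adaptiveGroupPointerLoss3 :
AdaptiveGroupPointerLoss3`** (`C = 1`, `s·t ≤ (log₂ n)^c`), the corollary **`parityDecisionTreeLoss3 : ParityDecisionTreeLoss3`**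
(`V = ZMod 2`: PARITY DECISION TREES of depth `t ≤ (log₂ n)^c` — indeed of every depth `t ≤ (n - 98)/24` by
`adaptiveGroupPointer_loss` — cannot locate a kernel position on more than `3/4` of the odd class), and
`groupHashPointerLoss3_of_adaptive` (the non-adaptive law is the depth-one constant scheme).

COVERAGE after parts A–C + `LocusDialAffinePointerA–D`: every pointer determined by `≤ (n-98)/24` adaptive GROUP-VALUED
linear measurements of the bit vector (subset parities, `𝔽₃`-forms, Hamming weights mod `m`, bit reads, juntas) loses
`≥ 1/4` of the odd class.  OPEN (g18, `FreePointerLoss3`): pointers needing NONLINEAR global aggregation at low `𝔽₃`-degree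
(quadratic forms first).  No `sorry`; standard axioms; no instances, no notation.
-/

set_option linter.dupNamespace false

noncomputable section

open scoped Classical

namespace Summit.QuantumAdvantage.QuantumAdvantage.Theorems.LocusDial

open Finset
open Literature.Computability.QuantumComplexity Literature.Computability.QuantumComplexity.RingHLF
open Summit.QuantumAdvantage.AdviceFreeQNC0
open Summit.QuantumAdvantage.QuantumAdvantage.Theorems.HolonomyDial (gCond)

/-! ## §L  ADAPTIVE group queries (group-valued decision trees; parity decision trees for `V = 𝔽₂`) -/

section GAdaptive
variable {N t : ℕ} {V : Type} [AddCommGroup V] [Fintype V] [DecidableEq V]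

/-- an ADAPTIVE group-query scheme of depth `t`: on answer string `w` the `j`-th queried coefficient vector `Gq w j`
(query value `Σ_{x_l = 1} Gq w j l ∈ V`) depends only on the earlier answers `w i`, `i < j`. -/
def GAdaptive (Gq : (Fin t → V) → Fin t → Fin N → V) : Prop :=
  ∀ v w : Fin t → V, ∀ j : Fin t, (∀ i : Fin t, i.val < j.val → v i = w i) → Gq v j = Gq w j

/-- the partial answer string after `j` queries (entries `≥ j` are `0`). -/
def gleafAux (Gq : (Fin t → V) → Fin t → Fin N → V) (x : Fin N → Bool) : ℕ → (Fin t → V)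
  | 0 => fun _ => 0
  | j + 1 => fun i => if i.val = j then ghash (Gq (gleafAux Gq x j) i) x else gleafAux Gq x j i

/-- the LEAF of input `x`: its full answer string. -/
def gleafOf (Gq : (Fin t → V) → Fin t → Fin N → V) (x : Fin N → Bool) : Fin t → V := gleafAux Gq x t

/-- the coefficient vectors of answer string `w`, bundled as ONE hash into the product group `Fin t → V`. -/
def gvec (Gq : (Fin t → V) → Fin t → Fin N → V) (w : Fin t → V) : Fin N → (Fin t → V) := fun l i => Gq w i l

omit [Fintype V] [DecidableEq V] in
/-- LocusDialGroupPointerC helper `ghash_gvec_apply` (decomp-qadv land package; see the module docstring). -/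
theorem ghash_gvec_apply (Gq : (Fin t → V) → Fin t → Fin N → V) (w : Fin t → V) (x : Fin N → Bool) (i : Fin t) :
    ghash (gvec Gq w) x i = ghash (Gq w i) x := by
  unfold ghash gvec
  rw [Finset.sum_apply]
  apply sum_congr rfl
  intro l _
  split_ifs <;> rfl

omit [Fintype V] [DecidableEq V] in
/-- LocusDialGroupPointerC helper `gleafAux_succ_apply` (decomp-qadv land package; see the module docstring). -/
theorem gleafAux_succ_apply (Gq : (Fin t → V) → Fin t → Fin N → V) (x : Fin N → Bool) (j : ℕ) (i : Fin t) :
    gleafAux Gq x (j + 1) i = if i.val = j then ghash (Gq (gleafAux Gq x j) i) x else gleafAux Gq x j i := rfl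

omit [Fintype V] [DecidableEq V] in
/-- LocusDialGroupPointerC helper `gleafAux_stable` (decomp-qadv land package; see the module docstring). -/
theorem gleafAux_stable (Gq : (Fin t → V) → Fin t → Fin N → V) (x : Fin N → Bool) (i : Fin t) :
    ∀ j : ℕ, i.val < j → gleafAux Gq x j i = gleafAux Gq x (i.val + 1) i := by
  intro j hj
  induction j with
  | zero => omega
  | succ j ih =>
    by_cases h : i.val = j
    · subst h; rfl
    · rw [gleafAux_succ_apply, if_neg h, ih (by omega)]

omit [Fintype V] [DecidableEq V] in
/-- LocusDialGroupPointerC helper `gleafOf_apply` (decomp-qadv land package; see the module docstring). -/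
theorem gleafOf_apply (Gq : (Fin t → V) → Fin t → Fin N → V) (x : Fin N → Bool) (i : Fin t) :
    gleafOf Gq x i = ghash (Gq (gleafAux Gq x i.val) i) x := by
  unfold gleafOf
  rw [gleafAux_stable Gq x i t i.isLt, gleafAux_succ_apply, if_pos rfl]

omit [Fintype V] [DecidableEq V] in
/-- LocusDialGroupPointerC helper `gleafAux_eq_gleafOf` (decomp-qadv land package; see the module docstring). -/
theorem gleafAux_eq_gleafOf (Gq : (Fin t → V) → Fin t → Fin N → V) (x : Fin N → Bool) (j : ℕ) (i : Fin t)
    (hi : i.val < j) : gleafAux Gq x j i = gleafOf Gq x i := by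
  unfold gleafOf
  rw [gleafAux_stable Gq x i j hi, gleafAux_stable Gq x i t i.isLt]

omit [Fintype V] [DecidableEq V] in
/-- the leaf answers its own queries. -/
theorem ghash_gleafOf {Gq : (Fin t → V) → Fin t → Fin N → V} (hG : GAdaptive Gq) (x : Fin N → Bool) :
    ghash (gvec Gq (gleafOf Gq x)) x = gleafOf Gq x := by
  funext i
  rw [ghash_gvec_apply, gleafOf_apply Gq x i,
    hG (gleafOf Gq x) (gleafAux Gq x i.val) i (fun l hl => (gleafAux_eq_gleafOf Gq x i.val l hl).symm)]

omit [Fintype V] [DecidableEq V] in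
/-- uniqueness: an answer string consistent with its own queries IS the leaf. -/
theorem eq_gleafOf_of_consistent {Gq : (Fin t → V) → Fin t → Fin N → V} (hG : GAdaptive Gq)
    (x : Fin N → Bool) (w : Fin t → V) (hw : ghash (gvec Gq w) x = w) : w = gleafOf Gq x := by
  have key : ∀ m : ℕ, ∀ i : Fin t, i.val < m → w i = gleafOf Gq x i := by
    intro m
    induction m with
    | zero => intro i hi; omega
    | succ m ih =>
      intro i hi
      by_cases him : i.val < m
      · exact ih i him
      · have hagree : ∀ l : Fin t, l.val < i.val → w l = gleafOf Gq x l := fun l hl => ih l (by omega)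
        rw [gleafOf_apply Gq x i, ← congrFun hw i, ghash_gvec_apply,
          hG w (gleafAux Gq x i.val) i (fun l hl => by rw [hagree l hl, gleafAux_eq_gleafOf Gq x i.val l hl])]
  funext i
  exact key t i i.isLt

omit [Fintype V] [DecidableEq V] in
/-- the fibres of the leaf map are the group-hash fibres of the leaf's own query bundle. -/
theorem gleafOf_eq_iff {Gq : (Fin t → V) → Fin t → Fin N → V} (hG : GAdaptive Gq) (x : Fin N → Bool)
    (w : Fin t → V) : gleafOf Gq x = w ↔ ghash (gvec Gq w) x = w :=
  ⟨fun h => by rw [← h]; exact ghash_gleafOf hG x, fun h => (eq_gleafOf_of_consistent hG x w h).symm⟩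

omit [AddCommGroup V] [Fintype V] [DecidableEq V] in
/-- a constant scheme is adaptive. -/
theorem gadaptive_const (G₀ : Fin t → Fin N → V) : GAdaptive (fun _ : Fin t → V => G₀) :=
  fun _ _ _ _ => rfl

omit [Fintype V] [DecidableEq V] in
/-- LocusDialGroupPointerC helper `gleafOf_const` (decomp-qadv land package; see the module docstring). -/
theorem gleafOf_const (G₀ : Fin t → Fin N → V) (x : Fin N → Bool) :
    gleafOf (fun _ : Fin t → V => G₀) x = ghash (gvec (fun _ : Fin t → V => G₀) (fun _ => 0)) x :=
  (gleafOf_eq_iff (gadaptive_const G₀) x _).2 rfl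

/-- **ADAPTIVE GROUP-QUERY POINTER LOSS** (all `n`, `s`, `t` with `24·s·t + 98 ≤ n`, `|V| ≤ 2^s`): a pointer that is ANY
lookup of the leaf of ANY adaptive `V`-valued query tree of depth `t` hits the kernel on at most `3/4` of `2^{n-1}`. -/
theorem adaptiveGroupPointer_loss (n s t : ℕ) (hN : 24 * (s * t) + 98 ≤ n) (hV : Fintype.card V ≤ 2 ^ s)
    (Gq : (Fin t → V) → Fin t → Fin n → V) (hG : GAdaptive Gq) (π : (Fin t → V) → Fin n) :
    ((univ.filter fun x : Fin n → Bool => OddZeros x ∧ gCond x (π (gleafOf Gq x)).val).card : ℝ) ≤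
      3 / 4 * (2 : ℝ) ^ (n - 1) := by
  have hVt : Fintype.card (Fin t → V) ≤ 2 ^ (s * t) := by
    rw [Fintype.card_fun, Fintype.card_fin, pow_mul]
    exact Nat.pow_le_pow_left hV t
  -- the sets
  set Odd := (univ : Finset (Fin n → Bool)).filter (fun x => OddZeros x) with hOdd
  set G : (Fin n → Bool) → Prop := fun x => gCond x (π (gleafOf Gq x)).val with hGdef
  set L := Odd.filter (fun x => kph x (π (gleafOf Gq x)).val = 2) with hL
  have hW : (univ.filter fun x : Fin n → Bool => OddZeros x ∧ gCond x (π (gleafOf Gq x)).val) = Odd.filter G := by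
    rw [hOdd, filter_filter]
  have hLG : L = Odd.filter (fun x => ¬ G x) := by
    rw [hL]
    apply filter_congr
    intro x _
    rw [hGdef]
    simp only [gCond_iff_kph, not_not]
  have hWL : (Odd.filter G).card + L.card = Odd.card := by
    rw [hLG]
    exact card_filter_add_card_filter_not _
  have hOdd_le : Odd.card ≤ 2 ^ (n - 1) := HolonomyDial.card_odd_le (by omega)
  -- fibres = group-hash fibres of the leaf's own bundle
  have hfibv : ∀ w : Fin t → V, Odd.filter (fun x => gleafOf Gq x = w) = gfib (gvec Gq w) w := by
    intro w
    unfold gfib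
    exact filter_congr (fun x _ => gleafOf_eq_iff hG x w)
  have hOdd_fib : Odd.card = ∑ w : Fin t → V, (gfib (gvec Gq w) w).card := by
    rw [card_eq_sum_card_fiberwise (f := fun x => gleafOf Gq x) (t := (univ : Finset (Fin t → V)))
      (fun x _ => mem_univ _)]
    exact sum_congr rfl (fun w _ => by rw [← hfibv w])
  have hL_fib : L.card = ∑ w : Fin t → V, ((gfib (gvec Gq w) w).filter (fun x => kph x (π w).val = 2)).card := by
    rw [card_eq_sum_card_fiberwise (f := fun x => gleafOf Gq x) (t := (univ : Finset (Fin t → V)))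
      (fun x _ => mem_univ _)]
    apply sum_congr rfl
    intro w _
    congr 1
    ext x
    rw [hL, hOdd]
    unfold gfib
    simp only [mem_filter, mem_univ, true_and]
    constructor
    · rintro ⟨⟨ho, hk⟩, hv⟩
      have hv' : ghash (gvec Gq w) x = w := (gleafOf_eq_iff hG x w).1 hv
      exact ⟨⟨ho, hv'⟩, by rw [← hv]; exact hk⟩
    · rintro ⟨⟨ho, hv'⟩, hk⟩
      have hv : gleafOf Gq x = w := (gleafOf_eq_iff hG x w).2 hv'
      exact ⟨⟨ho, by rw [hv]; exact hk⟩, hv⟩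
  have hTpos : (0 : ℝ) < Fintype.card (Fin t → V) := by exact_mod_cast Fintype.card_pos
  have hfib : ∀ w : Fin t → V, ((gfib (gvec Gq w) w).card : ℝ) ≤
      3 * ((gfib (gvec Gq w) w).filter (fun x => kph x (π w).val = 2)).card +
        2 ^ n / (8 * Fintype.card (Fin t → V)) := by
    intro w
    have h0 := set_count_le (gfib (gvec Gq w) w) (π w).val
    have h1 := gfibSum_bound (gvec Gq w) w (show (1 : ZMod 3) ≠ 0 by decide) (π w).val (s * t) hVt hN
    have h2 := gfibSum_bound (gvec Gq w) w (show (2 : ZMod 3) ≠ 0 by decide) (π w).val (s * t) hVt hN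
    have hb1 : ‖gfibSum (gvec Gq w) w 1 (π w).val‖ ≤ 2 ^ n / (16 * Fintype.card (Fin t → V)) := by
      rw [le_div_iff₀ (by positivity)]; linarith
    have hb2 : ‖gfibSum (gvec Gq w) w 2 (π w).val‖ ≤ 2 ^ n / (16 * Fintype.card (Fin t → V)) := by
      rw [le_div_iff₀ (by positivity)]; linarith
    have e : (2 : ℝ) ^ n / (16 * Fintype.card (Fin t → V)) + 2 ^ n / (16 * Fintype.card (Fin t → V)) =
        2 ^ n / (8 * Fintype.card (Fin t → V)) := by
      field_simp; ring
    unfold gfibSum at hb1 hb2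
    linarith
  have hmain : (Odd.card : ℝ) ≤ 3 * L.card + 2 ^ n / 8 := by
    rw [hOdd_fib, hL_fib]
    push_cast
    have hs := sum_le_sum (fun w (_ : w ∈ (univ : Finset (Fin t → V))) => hfib w)
    rw [sum_add_distrib, sum_const, card_univ, nsmul_eq_mul, ← mul_sum] at hs
    have e : (Fintype.card (Fin t → V) : ℝ) * (2 ^ n / (8 * Fintype.card (Fin t → V))) = 2 ^ n / 8 := by
      field_simp
    linarith
  -- the count
  rw [hW]
  have hWr : ((Odd.filter G).card : ℝ) = Odd.card - L.card := by
    have := congrArg (fun m : ℕ => (m : ℝ)) hWL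
    push_cast at this
    linarith
  have hOl : (Odd.card : ℝ) ≤ 2 ^ (n - 1) := by exact_mod_cast hOdd_le
  have hpow : (2 : ℝ) ^ n = 2 * 2 ^ (n - 1) := by
    rw [← pow_succ']; congr 1; omega
  rw [hWr]
  linarith

/-- **`AdaptiveGroupPointerLoss3`**: no pointer that is a lookup of the leaf of an adaptive `V`-valued query tree of depth
`t`, `|V| ≤ 2^s`, `s·t ≤ (log₂ n)^c`, hits the kernel on all but a polynomial fraction of the odd class.  For `V = 𝔽₂`
these are PARITY DECISION TREES (`parityDecisionTreeLoss3`); for `V = 𝔽₃` the `𝔽₃`-parity decision trees of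
`AdaptiveAffinePointerLoss3`. -/
def AdaptiveGroupPointerLoss3 : Prop :=
  ∃ C : ℕ, ∀ c : ℕ, ∃ n₀ : ℕ, ∀ n ≥ n₀, ∀ s t : ℕ, s * t ≤ (Nat.log 2 n) ^ c →
    ∀ (V : Type) [AddCommGroup V] [Fintype V] [DecidableEq V], Fintype.card V ≤ 2 ^ s →
      ∀ Gq : (Fin t → V) → Fin t → Fin n → V, GAdaptive Gq → ∀ π : (Fin t → V) → Fin n,
        ((univ.filter fun x : Fin n → Bool => OddZeros x ∧ gCond x (π (gleafOf Gq x)).val).card : ℝ) ≤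
          (1 - 1 / (n : ℝ) ^ C) * (2 : ℝ) ^ (n - 1)

end GAdaptive

/-- **`AdaptiveGroupPointerLoss3` PROVED** (`C = 1`). -/
theorem adaptiveGroupPointerLoss3 : AdaptiveGroupPointerLoss3 := by
  refine ⟨1, fun c => ?_⟩
  obtain ⟨n₁, hn₁⟩ := TubePlanProof.logPow_le_natSqrt c
  refine ⟨max n₁ 4096, fun n hn s t hst V _ _ _ hV Gq hG π => ?_⟩
  have hn1 : n₁ ≤ n := le_trans (le_max_left _ _) hn
  have h4096 : 4096 ≤ n := le_trans (le_max_right _ _) hn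
  have hsq : (Nat.log 2 n) ^ c ≤ Nat.sqrt n := hn₁ n hn1
  have hs64 : 64 ≤ Nat.sqrt n := Nat.le_sqrt.2 (by omega)
  have hss : Nat.sqrt n * Nat.sqrt n ≤ n := Nat.sqrt_le n
  have hsN : 24 * (s * t) + 98 ≤ n := by nlinarith [hst, hsq, hs64, hss]
  have h := adaptiveGroupPointer_loss n s t hsN hV Gq hG π
  have hn4 : (4 : ℝ) ≤ n := by exact_mod_cast h4096.trans' (by norm_num)
  have h1n : 1 / (n : ℝ) ^ 1 ≤ 1 / 4 := by
    rw [pow_one]; exact one_div_le_one_div_of_le (by norm_num) hn4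
  have hpos : (0 : ℝ) ≤ 2 ^ (n - 1) := by positivity
  have hrhs : (3 / 4 : ℝ) * 2 ^ (n - 1) ≤ (1 - 1 / (n : ℝ) ^ 1) * 2 ^ (n - 1) :=
    mul_le_mul_of_nonneg_right (by linarith) hpos
  linarith

/-- **PARITY DECISION TREES**: `V = ZMod 2`.  No pointer computed from the leaf of a parity decision tree of depth
`t ≤ (log₂ n)^c` (each query = the parity of an adaptively chosen subset of the bits) hits the kernel on all but a
polynomial fraction of the odd class. -/
def ParityDecisionTreeLoss3 : Prop :=
  ∃ C : ℕ, ∀ c : ℕ, ∃ n₀ : ℕ, ∀ n ≥ n₀, ∀ t : ℕ, t ≤ (Nat.log 2 n) ^ c →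
    ∀ Gq : (Fin t → ZMod 2) → Fin t → Fin n → ZMod 2, GAdaptive Gq → ∀ π : (Fin t → ZMod 2) → Fin n,
      ((univ.filter fun x : Fin n → Bool => OddZeros x ∧ gCond x (π (gleafOf Gq x)).val).card : ℝ) ≤
        (1 - 1 / (n : ℝ) ^ C) * (2 : ℝ) ^ (n - 1)

/-- **`ParityDecisionTreeLoss3` PROVED** (from `adaptiveGroupPointerLoss3`, `s = 1`). -/
theorem parityDecisionTreeLoss3 : ParityDecisionTreeLoss3 := by
  obtain ⟨C, hC⟩ := adaptiveGroupPointerLoss3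
  refine ⟨C, fun c => ?_⟩
  obtain ⟨n₀, hn₀⟩ := hC c
  refine ⟨n₀, fun n hn t ht Gq hG π => ?_⟩
  have hV : Fintype.card (ZMod 2) ≤ 2 ^ 1 := by rw [ZMod.card]; norm_num
  exact hn₀ n hn 1 t (by simpa using ht) (ZMod 2) hV Gq hG π

/-- the non-adaptive group law is the depth-one constant-scheme case of the adaptive one. -/
theorem groupHashPointerLoss3_of_adaptive (h : AdaptiveGroupPointerLoss3) : GroupHashPointerLoss3 := by
  obtain ⟨C, hC⟩ := h
  refine ⟨C, fun c => ?_⟩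
  obtain ⟨n₀, hn₀⟩ := hC c
  refine ⟨n₀, fun n hn s hs V _ _ _ hV g π => ?_⟩
  have h := hn₀ n hn s 1 (by simpa using hs) V hV (fun _ : Fin 1 → V => fun _ : Fin 1 => g)
    (gadaptive_const (fun _ : Fin 1 => g)) (fun w => π (w 0))
  have e : ∀ x : Fin n → Bool,
      (gleafOf (fun _ : Fin 1 → V => fun _ : Fin 1 => g) x) 0 = ghash g x := by
    intro x
    rw [gleafOf_const, ghash_gvec_apply]
  have hset : (univ.filter fun x : Fin n → Bool => OddZeros x ∧ gCond x (π (ghash g x)).val) =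
      (univ.filter fun x : Fin n → Bool => OddZeros x ∧
        gCond x (π ((gleafOf (fun _ : Fin 1 → V => fun _ : Fin 1 => g) x) 0)).val) := by
    apply filter_congr
    intro x _
    rw [e x]
  rw [hset]
  exact h

end Summit.QuantumAdvantage.QuantumAdvantage.Theorems.LocusDial
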